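import Summits.Ventures.PercRepro.C041TriangleStarFamily

/-!
# EVERY MARKED VERTEX AGAINST EVERY TWO-LEAF STAR — `θ_△(X(p,q), v a * v b)` in the cone for ALL marks and ALL
`a, b ∈ [0, 1]` (mine-3, gen 61; C-041.md §21 (an))

No new LP: `X(p,q) = X(1,1) + sh p • e_{T₁} + sh q • e_{T₂}` (`p, q ≥ 1`, `sh n = 2^n − 2`) and `θ_△` is linear in each
zone, so the doubly-marked family reduces to the (1,1)-vertex against the star (`InCone_thetaTri_X11_star2`, kit j284468)
and the two RAYS `e_{T₁} = (0, 1, 0, 0, 0, 0)`, `e_{T₂} = (0, 0, 1, 0, 0, 0)` against the star — and the ray identities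
are the `sh p`- / `sh q`-parts of the one-type family certificates `thetaTri_pow_one_star2` / `thetaTri_pow_zero_star2`
(kit j286713; 8 generators each, Bernstein-quadratic coefficients).  THEOREM `InCone_thetaTri_marks_star2 (p q : ℕ)`:
the triangle with ANY marked vertex at one exit and ANY two-leaf star at the other lies in the cone; mirror
`InCone_thetaTri_star2_marks`; every two-exit cycle carrying them `InCone_thetaCyc_marks_star2`.
-/

namespace PercRepro

namespace RelaxedTriangle

open TreeClosure

/-- `X(p,q) = X(1,1) + sh p • e_{T₁} + sh q • e_{T₂}` for `p, q ≥ 1`. -/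
theorem pow_v_one_mul_pow_v_zero_eq_add (p q : ℕ) (hp : 1 ≤ p) (hq : 1 ≤ q) :
    v 1 ^ p * v 0 ^ q = v 1 * v 0 + sh p • ![0, 1, 0, 0, 0, 0] + sh q • ![0, 0, 1, 0, 0, 0] := by
  rw [pow_v_one_mul_pow_v_zero_eq p q hp hq]
  ext i
  simp only [Pi.add_apply, Pi.smul_apply, Pi.mul_apply, smul_eq_mul, v, sh]
  fin_cases i <;> simp <;> ring

/-- **THE RAY `e_{T₁}` AGAINST A TWO-LEAF STAR**: `θ_△(e_{T₁}, v a * v b)` as a non-negative combination of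
8 generators with Bernstein-quadratic coefficients in each of `a`, `b` — the `sh p`-part of the `X(p,0) × v a * v b` identity (`thetaTri_pow_one_star2`),
since `X(p,0) = v 1 + sh p • e_{T₁}` and `X(0,q) = v 0 + sh q • e_{T₂}` and `θ_△` is linear (kit j286713). -/
theorem thetaTri_eT1_star2 (a b : ℝ) :
    thetaTri ![0, 1, 0, 0, 0, 0] (v a * v b) =
      ((1 : ℝ) * (1 - a) * (1 - a) * (1 - b) * (1 - b)
          + (3 / 2 : ℝ) * (1 - a) * (1 - a) * b * (1 - b) + (2 : ℝ) * a * (1 - a) * (1 - b) * (1 - b)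
          + (3 : ℝ) * a * (1 - a) * b * (1 - b) + (1 : ℝ) * a * (1 - a) * b * b
          + (1 : ℝ) * a * a * (1 - b) * (1 - b) + (3 / 2 : ℝ) * a * a * b * (1 - b)
          + (1 : ℝ) * a * a * b * b) • (v 1 * v a)
      + ((1 : ℝ) * (1 - a) * (1 - a) * (1 - b) * (1 - b) + (2 : ℝ) * (1 - a) * (1 - a) * b * (1 - b)
          + (1 : ℝ) * (1 - a) * (1 - a) * b * b + (3 / 2 : ℝ) * a * (1 - a) * (1 - b) * (1 - b)
          + (3 : ℝ) * a * (1 - a) * b * (1 - b) + (3 / 2 : ℝ) * a * (1 - a) * b * b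
          + (1 : ℝ) * a * a * b * (1 - b) + (1 : ℝ) * a * a * b * b) • (v 1 * v b)
      + ((4 : ℝ) * (1 - a) * (1 - a) * b * b + (4 : ℝ) * a * (1 - a) * b * b) • (v 1 * v ((1 + a) / 2))
      + ((4 : ℝ) * a * a * (1 - b) * (1 - b) + (4 : ℝ) * a * a * b * (1 - b)) • (v 1 * v ((1 + b) / 2))
      + ((2 : ℝ) * a * (1 - a) * b * (1 - b) + (2 : ℝ) * a * (1 - a) * b * b
          + (2 : ℝ) * a * a * b * (1 - b) + (2 : ℝ) * a * a * b * b) • v 1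
      + ((4 : ℝ) * (1 - a) * (1 - a) * (1 - b) * (1 - b)) • (v 1 * v (1 / 2))
      + ((9 / 2 : ℝ) * (1 - a) * (1 - a) * b * (1 - b)
          + (9 / 2 : ℝ) * a * (1 - a) * (1 - b) * (1 - b)) • (v 1 * v (2 / 3))
      + ((1 : ℝ) * (1 - a) * (1 - a) * b * b + (4 : ℝ) * a * (1 - a) * b * (1 - b)
          + (3 / 2 : ℝ) * a * (1 - a) * b * b + (1 : ℝ) * a * a * (1 - b) * (1 - b)
          + (3 / 2 : ℝ) * a * a * b * (1 - b) + (5 : ℝ) * a * a * b * b) • (v 1 * v 1) := by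
  ext i
  simp only [thetaTri_eq_vec, Pi.add_apply, Pi.smul_apply, Pi.mul_apply, smul_eq_mul, v]
  fin_cases i <;> simp <;> ring

/-- The ray `e_{T₁}` against ANY two-leaf star gives a cone member (all `a, b ∈ [0, 1]`). -/
theorem InCone_thetaTri_eT1_star2 (a b : ℝ) (ha : 0 ≤ a ∧ a ≤ 1) (hb : 0 ≤ b ∧ b ≤ 1) :
    InCone (thetaTri ![0, 1, 0, 0, 0, 0] (v a * v b)) := by
  rw [thetaTri_eT1_star2 a b]
  have ha0 : 0 ≤ a := ha.1
  have ha1 : 0 ≤ 1 - a := by linarith [ha.2]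
  have hb0 : 0 ≤ b := hb.1
  have hb1 : 0 ≤ 1 - b := by linarith [hb.2]
  have ham : 0 ≤ (1 + a) / 2 ∧ (1 + a) / 2 ≤ 1 := ⟨by linarith, by linarith [ha.2]⟩
  have hbm : 0 ≤ (1 + b) / 2 ∧ (1 + b) / 2 ≤ 1 := ⟨by linarith, by linarith [hb.2]⟩
  exact (((((((InCone.smul _ (by positivity) ((InCone_v1).mul (InCone_v a ha))).add
    (InCone.smul _ (by positivity) ((InCone_v1).mul (InCone_v b hb)))).add
    (InCone.smul _ (by positivity) ((InCone_v1).mul (InCone_v ((1 + a) / 2) ham)))).add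
    (InCone.smul _ (by positivity) ((InCone_v1).mul (InCone_v ((1 + b) / 2) hbm)))).add
    (InCone.smul _ (by positivity) (InCone_v1))).add
    (InCone.smul _ (by positivity) ((InCone_v1).mul (InCone_vh)))).add
    (InCone.smul _ (by positivity) ((InCone_v1).mul (InCone_v_twothirds)))).add
    (InCone.smul _ (by positivity) ((InCone_v1).mul (InCone_v1)))

/-- **THE RAY `e_{T₂}` AGAINST A TWO-LEAF STAR**: `θ_△(e_{T₂}, v a * v b)` as a non-negative combination of
8 generators with Bernstein-quadratic coefficients in each of `a`, `b` — the `sh q`-part of the `X(0,q) × v a * v b` identity (`thetaTri_pow_zero_star2`),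
since `X(p,0) = v 1 + sh p • e_{T₁}` and `X(0,q) = v 0 + sh q • e_{T₂}` and `θ_△` is linear (kit j286713). -/
theorem thetaTri_eT2_star2 (a b : ℝ) :
    thetaTri ![0, 0, 1, 0, 0, 0] (v a * v b) =
      ((3 / 2 : ℝ) * (1 - a) * (1 - a) * b * (1 - b) + (1 : ℝ) * (1 - a) * (1 - a) * b * b
          + (1 / 2 : ℝ) * a * (1 - a) * (1 - b) * (1 - b) + (3 : ℝ) * a * (1 - a) * b * (1 - b)
          + (2 : ℝ) * a * (1 - a) * b * b + (1 / 2 : ℝ) * a * a * (1 - b) * (1 - b)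
          + (3 / 2 : ℝ) * a * a * b * (1 - b) + (1 : ℝ) * a * a * b * b) • (v 0 * v a)
      + ((2 : ℝ) * (1 - a) * (1 - a) * (1 - b) * (1 - b)
          + (2 : ℝ) * a * (1 - a) * (1 - b) * (1 - b)) • (v 0 * v (a / 2))
      + ((1 / 2 : ℝ) * (1 - a) * (1 - a) * b * (1 - b) + (1 / 2 : ℝ) * (1 - a) * (1 - a) * b * b
          + (3 / 2 : ℝ) * a * (1 - a) * (1 - b) * (1 - b) + (3 : ℝ) * a * (1 - a) * b * (1 - b)
          + (3 / 2 : ℝ) * a * (1 - a) * b * b + (1 : ℝ) * a * a * (1 - b) * (1 - b)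
          + (2 : ℝ) * a * a * b * (1 - b) + (1 : ℝ) * a * a * b * b) • (v 0 * v b)
      + ((2 : ℝ) * (1 - a) * (1 - a) * (1 - b) * (1 - b)
          + (2 : ℝ) * (1 - a) * (1 - a) * b * (1 - b)) • (v 0 * v (b / 2))
      + ((2 : ℝ) * (1 - a) * (1 - a) * (1 - b) * (1 - b) + (2 : ℝ) * (1 - a) * (1 - a) * b * (1 - b)
          + (2 : ℝ) * a * (1 - a) * (1 - b) * (1 - b) + (2 : ℝ) * a * (1 - a) * b * (1 - b)) • v 0
      + ((9 / 2 : ℝ) * (1 - a) * (1 - a) * b * b + (9 / 2 : ℝ) * a * (1 - a) * b * b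
          + (9 / 2 : ℝ) * a * a * (1 - b) * (1 - b) + (9 / 2 : ℝ) * a * a * b * (1 - b)) • (v 0 * v (1 / 3))
      + ((3 : ℝ) * (1 - a) * (1 - a) * (1 - b) * (1 - b) + (4 : ℝ) * (1 - a) * (1 - a) * b * (1 - b)
          + (4 : ℝ) * a * (1 - a) * (1 - b) * (1 - b) + (4 : ℝ) * a * (1 - a) * b * (1 - b)) • (v 0 * v 0)
      + ((4 : ℝ) * a * a * b * b) • (v 0 * v (1 / 2)) := by
  ext i
  simp only [thetaTri_eq_vec, Pi.add_apply, Pi.smul_apply, Pi.mul_apply, smul_eq_mul, v]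
  fin_cases i <;> simp <;> ring

/-- The ray `e_{T₂}` against ANY two-leaf star gives a cone member (all `a, b ∈ [0, 1]`). -/
theorem InCone_thetaTri_eT2_star2 (a b : ℝ) (ha : 0 ≤ a ∧ a ≤ 1) (hb : 0 ≤ b ∧ b ≤ 1) :
    InCone (thetaTri ![0, 0, 1, 0, 0, 0] (v a * v b)) := by
  rw [thetaTri_eT2_star2 a b]
  have ha0 : 0 ≤ a := ha.1
  have ha1 : 0 ≤ 1 - a := by linarith [ha.2]
  have hb0 : 0 ≤ b := hb.1
  have hb1 : 0 ≤ 1 - b := by linarith [hb.2]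
  have hah : 0 ≤ a / 2 ∧ a / 2 ≤ 1 := ⟨by linarith, by linarith [ha.2]⟩
  have hbh : 0 ≤ b / 2 ∧ b / 2 ≤ 1 := ⟨by linarith, by linarith [hb.2]⟩
  exact (((((((InCone.smul _ (by positivity) ((InCone_v0).mul (InCone_v a ha))).add
    (InCone.smul _ (by positivity) ((InCone_v0).mul (InCone_v (a / 2) hah)))).add
    (InCone.smul _ (by positivity) ((InCone_v0).mul (InCone_v b hb)))).add
    (InCone.smul _ (by positivity) ((InCone_v0).mul (InCone_v (b / 2) hbh)))).add
    (InCone.smul _ (by positivity) (InCone_v0))).add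
    (InCone.smul _ (by positivity) ((InCone_v0).mul (InCone_v_third)))).add
    (InCone.smul _ (by positivity) ((InCone_v0).mul (InCone_v0)))).add
    (InCone.smul _ (by positivity) ((InCone_v0).mul (InCone_vh)))
/-- **THE DOUBLY-MARKED SHAPE**: `X(p,q)` (`p, q ≥ 1`) against ANY two-leaf star lies in the cone — by linearity from the
(1,1)-vertex and the two rays. -/
theorem InCone_thetaTri_marks_star2' (p q : ℕ) (hp : 1 ≤ p) (hq : 1 ≤ q) (a b : ℝ) (ha : 0 ≤ a ∧ a ≤ 1)
    (hb : 0 ≤ b ∧ b ≤ 1) : InCone (thetaTri (v 1 ^ p * v 0 ^ q) (v a * v b)) := by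
  rw [pow_v_one_mul_pow_v_zero_eq_add p q hp hq, thetaTri_add_left, thetaTri_add_left, thetaTri_smul_left,
    thetaTri_smul_left]
  exact ((InCone_thetaTri_X11_star2 a b ha hb).add
    ((InCone_thetaTri_eT1_star2 a b ha hb).smul _ (sh_nonneg p hp))).add
    ((InCone_thetaTri_eT2_star2 a b ha hb).smul _ (sh_nonneg q hq))

/-- **THEOREM (TRIANGLE, any marked vertex × any two-leaf star)**: for all `p, q ≥ 0` and `a, b ∈ [0, 1]`,
`θ_△(X(p,q), v a * v b)` lies in the cone. -/
theorem InCone_thetaTri_marks_star2 (p q : ℕ) (a b : ℝ) (ha : 0 ≤ a ∧ a ≤ 1) (hb : 0 ≤ b ∧ b ≤ 1) :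
    InCone (thetaTri (v 1 ^ p * v 0 ^ q) (v a * v b)) := by
  by_cases hp : p = 0
  · subst hp
    by_cases hq : q = 0
    · subst hq
      simp only [pow_zero, mul_one]
      rw [thetaTri_comm]
      exact InCone_thetaTri_one ((InCone_v a ha).mul (InCone_v b hb))
    · simp only [pow_zero, one_mul]
      exact InCone_thetaTri_pow_zero_star2 q (Nat.one_le_iff_ne_zero.mpr hq) a b ha hb
  · by_cases hq : q = 0
    · subst hq
      simp only [pow_zero, mul_one]
      exact InCone_thetaTri_pow_one_star2 p (Nat.one_le_iff_ne_zero.mpr hp) a b ha hb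
    · exact InCone_thetaTri_marks_star2' p q (Nat.one_le_iff_ne_zero.mpr hp) (Nat.one_le_iff_ne_zero.mpr hq) a b ha hb

/-- The mirror `θ_△(v a * v b, X(p,q))`. -/
theorem InCone_thetaTri_star2_marks (p q : ℕ) (a b : ℝ) (ha : 0 ≤ a ∧ a ≤ 1) (hb : 0 ≤ b ∧ b ≤ 1) :
    InCone (thetaTri (v a * v b) (v 1 ^ p * v 0 ^ q)) := by
  rw [thetaTri_comm]
  exact InCone_thetaTri_marks_star2 p q a b ha hb

/-- **Every two-exit cycle carrying a marked vertex and a two-leaf star lies in the cone** (any marks, any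
`a, b ∈ [0, 1]`, any length and positions). -/
theorem InCone_thetaCyc_marks_star2 (p₀ q₀ : ℕ) (a b : ℝ) (ha : 0 ≤ a ∧ a ≤ 1) (hb : 0 ≤ b ∧ b ≤ 1)
    {p q s : ℝ} (hp : 0 ≤ p) (hq : 0 ≤ q) (hs : 0 ≤ s) :
    InCone (thetaCyc p q s (v 1 ^ p₀ * v 0 ^ q₀) (v a * v b)) :=
  InCone_thetaCyc_of_InCone_tri ((InCone_pow_v_one p₀).mul (InCone_pow_v_zero q₀)) ((InCone_v a ha).mul (InCone_v b hb))
    (InCone_thetaTri_marks_star2 p₀ q₀ a b ha hb) hp hq hs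

end RelaxedTriangle

end PercRepro
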